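import Mathlib
import HarnessLib
import Literature.Analysis.FluidPDE.SuitableWeak
import Literature.Analysis.FluidPDE.CKN1982Setting
import Summits.NavierStokesRegularity.NavierStokesRegularity.Theorems.TypeILiouvilleTypeIliouvilleNoTypeIIEternalInheritance

/-!
# Door S31 `QuietScarPocketDoor`, K-piece PK1 `scarPocketZoom_holds` — STUB F3b `ae_apex_of_classZoom`:
# the one-point bound passes to the `L³_loc` limit almost everywhere on the slab

Width-seat file (prover ns-sz-p1 g4 under LEAD ns-s30-p1; PK1 skeleton `PK1-Skeleton.lean` sha16
e9d92a063109a968, stub F3b verbatim).  If `w_k` satisfies the one-point bound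
`|w_k(t,x)| ≤ C_u/(√(−t) + |x|)` on `Q(0, R_k)` with `R_k → ∞`, `U` is continuous on the open past
slab and `w_k → U` in `L³(Q(0,r))` for every `r > 0`, then `|U(t,x)| ≤ C_u/(|x| + √(−t))` for a.e.
`(t,x)` with `t < 0`.  No measurability of the `w_k` is needed: if the bound failed by `δ` on a set
`A ⊆ Q(0,r)` of positive measure (a relatively open set, `U` and the majorant being continuous),
then `|w_k − U| > δ` on `A` once `R_k ≥ r`, so `‖w_k − U‖_{L³(Q(0,r))} ≥ (δ³ |A|)^{1/3}` for all
large `k` — contradicting the `L³` convergence (`lintegral` is monotone for arbitrary integrands).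

HONEST FRAMING: a by-name helper for item 0056 (`--supports … --as helper`); door S31, PK1, item 0056
`NoTypeII` and the summit are OPEN; nothing here is credited toward them.
-/

noncomputable section

set_option linter.dupNamespace false

namespace Summit.NavierStokesRegularity.NavierStokesRegularity.Theorems.QuietScarPocketDoor

open MeasureTheory Set Function Filter Topology TopologicalSpace Metric
open scoped NNReal ENNReal Topology
open Literature.Analysis Literature.Analysis.FluidPDE

/-- **Lower bound for an `L³` distance from a pointwise gap on a set** (no measurability of `g`):
if `‖g z − h z‖ ≥ δ` on a measurable `A ⊆ S`, then
`(δ³ · |A|)^{1/3} ≤ ‖g − h‖_{L³(S)}`. -/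
theorem rpow_mul_volume_le_eLpNorm_three {S A : Set (ℝ × EuclideanSpace ℝ (Fin 3))}
    (hA : MeasurableSet A) (hAS : A ⊆ S)
    {g h : ℝ × EuclideanSpace ℝ (Fin 3) → EuclideanSpace ℝ (Fin 3)} {δ : ℝ}
    (hgap : ∀ z ∈ A, δ ≤ ‖g z - h z‖) :
    (ENNReal.ofReal δ ^ (3 : ℝ) * volume A) ^ (1 / (3 : ℝ)) ≤ eLpNorm (g - h) 3 (volume.restrict S) := by
  rw [eLpNorm_eq_lintegral_rpow_enorm_toReal (by norm_num) (by norm_num)]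
  have h3 : ((3 : ℝ≥0∞)).toReal = (3 : ℝ) := by norm_num
  rw [h3]
  refine ENNReal.rpow_le_rpow ?_ (by norm_num)
  calc ENNReal.ofReal δ ^ (3 : ℝ) * volume A
      = ∫⁻ z in S, A.indicator (fun _ => ENNReal.ofReal δ ^ (3 : ℝ)) z := by
        rw [lintegral_indicator hA, setLIntegral_const, Measure.restrict_apply hA,
          inter_eq_left.2 hAS]
    _ ≤ ∫⁻ z in S, ‖(g - h) z‖ₑ ^ (3 : ℝ) := by
        refine lintegral_mono fun z => ?_
        by_cases hz : z ∈ A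
        · rw [indicator_of_mem hz, Pi.sub_apply]
          refine ENNReal.rpow_le_rpow ?_ (by norm_num)
          rw [← ofReal_norm]
          exact ENNReal.ofReal_le_ofReal (hgap z hz)
        · rw [indicator_of_notMem hz]
          exact bot_le

/-- On ONE cylinder `Q(0, r)`: the one-point bound passes to the `L³(Q(0,r))` limit a.e. -/
theorem ae_apex_of_classZoom_cylinder {Cu : ℝ}
    {w : ℕ → ℝ → EuclideanSpace ℝ (Fin 3) → EuclideanSpace ℝ (Fin 3)} {Rk : ℕ → ℝ}
    {U : ℝ → EuclideanSpace ℝ (Fin 3) → EuclideanSpace ℝ (Fin 3)}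
    (hRk : Tendsto Rk atTop atTop)
    (hone : ∀ k, ∀ z ∈ parabolicCylinder (Rk k) (0 : ℝ × EuclideanSpace ℝ (Fin 3)),
      ‖w k z.1 z.2‖ ≤ Cu / (Real.sqrt (-z.1) + ‖z.2‖))
    (hUm : ContinuousOn (uncurry U) (Iio (0 : ℝ) ×ˢ univ))
    {r : ℝ} (hr : 0 < r)
    (hL3 : Tendsto (fun k => eLpNorm (uncurry (w k) - uncurry U) 3
      (volume.restrict (parabolicCylinder r (0 : ℝ × EuclideanSpace ℝ (Fin 3))))) atTop (𝓝 0)) :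
    ∀ᵐ z ∂(volume.restrict (parabolicCylinder r (0 : ℝ × EuclideanSpace ℝ (Fin 3)))),
      ‖U z.1 z.2‖ ≤ Cu / (‖z.2‖ + Real.sqrt (-z.1)) := by
  set Q : Set (ℝ × EuclideanSpace ℝ (Fin 3)) := parabolicCylinder r (0 : ℝ × EuclideanSpace ℝ (Fin 3))
    with hQ
  have hQopen : IsOpen Q := isOpen_parabolicCylinder _ _
  have hQslab : Q ⊆ Iio (0 : ℝ) ×ˢ univ := by
    intro z hz
    rw [hQ, mem_parabolicCylinder] at hz
    exact ⟨hz.1.2, mem_univ _⟩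
  -- the defect `f z = ‖U z‖ − C_u/(‖x‖ + √(−t))`, continuous on `Q`
  set b : ℝ × EuclideanSpace ℝ (Fin 3) → ℝ := fun z => Cu / (‖z.2‖ + Real.sqrt (-z.1)) with hb
  set f : ℝ × EuclideanSpace ℝ (Fin 3) → ℝ := fun z => ‖uncurry U z‖ - b z with hf
  have hbcont : ContinuousOn b Q := by
    refine continuousOn_const.div (by fun_prop) fun z hz => ?_
    have ht : z.1 < 0 := (hQslab hz).1
    have : 0 < Real.sqrt (-z.1) := Real.sqrt_pos.2 (by linarith)
    positivity
  have hfcont : ContinuousOn f Q := (hUm.mono hQslab).norm.sub hbcont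
  -- it suffices: for every `n`, the set `Q ∩ {f > 1/(n+1)}` is null
  suffices hnull : ∀ n : ℕ, volume (Q ∩ f ⁻¹' Ioi (1 / ((n : ℝ) + 1))) = 0 by
    have hall : ∀ᵐ z ∂(volume.restrict Q), ∀ n : ℕ, ¬ (1 / ((n : ℝ) + 1) < f z) := by
      rw [ae_all_iff]
      intro n
      rw [ae_restrict_iff' hQopen.measurableSet, ae_iff]
      have e : {a | ¬ (a ∈ Q → ¬ 1 / ((n : ℝ) + 1) < f a)} = Q ∩ f ⁻¹' Ioi (1 / ((n : ℝ) + 1)) := by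
        ext a; simp [mem_Ioi]
      rw [e]
      exact hnull n
    filter_upwards [hall] with z hz
    have hle : f z ≤ 0 := by
      refine le_of_forall_pos_lt_add fun ε hε => ?_
      obtain ⟨n, hn⟩ := exists_nat_one_div_lt hε
      have := not_lt.1 (hz n)
      linarith
    have hfz : f z = ‖U z.1 z.2‖ - Cu / (‖z.2‖ + Real.sqrt (-z.1)) := rfl
    linarith
  intro n
  set δ : ℝ := 1 / ((n : ℝ) + 1) with hδ
  have hδpos : 0 < δ := by positivity
  set A : Set (ℝ × EuclideanSpace ℝ (Fin 3)) := Q ∩ f ⁻¹' Ioi δ with hA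
  have hAopen : IsOpen A := hfcont.isOpen_inter_preimage hQopen isOpen_Ioi
  have hAQ : A ⊆ Q := inter_subset_left
  have hAtop : volume A ≠ ⊤ :=
    ((measure_mono hAQ).trans_lt
      (Summit.NavierStokesRegularity.NavierStokesRegularity.Theorems.TypeIliouvilleNoTypeII.EternalSplit.volume_parabolicCylinder_lt_top
        r 0)).ne
  by_contra hpos
  -- the constant lower bound `c = (δ³ |A|)^{1/3} > 0`
  set c : ℝ≥0∞ := (ENNReal.ofReal δ ^ (3 : ℝ) * volume A) ^ (1 / (3 : ℝ)) with hc
  have hc0 : c ≠ 0 := by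
    have h1 : ENNReal.ofReal δ ^ (3 : ℝ) * volume A ≠ 0 :=
      mul_ne_zero (ENNReal.rpow_pos (ENNReal.ofReal_pos.2 hδpos) ENNReal.ofReal_ne_top).ne' hpos
    exact (ENNReal.rpow_pos (pos_iff_ne_zero.2 h1)
      (ENNReal.mul_ne_top (ENNReal.rpow_ne_top_of_nonneg (by norm_num) ENNReal.ofReal_ne_top) hAtop)).ne'
  -- eventually `R_k ≥ r`, and then the `L³` distance is `≥ c`
  have hev : ∀ᶠ k in atTop, c ≤ eLpNorm (uncurry (w k) - uncurry U) 3 (volume.restrict Q) := by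
    filter_upwards [hRk.eventually_ge_atTop r] with k hk
    refine rpow_mul_volume_le_eLpNorm_three hAopen.measurableSet hAQ fun z hz => ?_
    have hzQ : z ∈ Q := hAQ hz
    have hzQk : z ∈ parabolicCylinder (Rk k) (0 : ℝ × EuclideanSpace ℝ (Fin 3)) :=
      parabolicCylinder_mono hr.le hk _ hzQ
    have hw : ‖w k z.1 z.2‖ ≤ b z := by
      have := hone k z hzQk
      rw [hb]; dsimp only; rwa [add_comm]
    have hfz : δ < ‖uncurry U z‖ - b z := hz.2
    have hwz : ‖uncurry (w k) z‖ ≤ b z := hw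
    calc δ ≤ ‖uncurry U z‖ - ‖uncurry (w k) z‖ := by linarith
      _ ≤ ‖uncurry U z - uncurry (w k) z‖ := norm_sub_norm_le _ _
      _ = ‖uncurry (w k) z - uncurry U z‖ := norm_sub_rev _ _
  have hsmall : ∀ᶠ k in atTop, eLpNorm (uncurry (w k) - uncurry U) 3 (volume.restrict Q) < c :=
    (tendsto_order.1 hL3).2 c (pos_iff_ne_zero.2 hc0)
  obtain ⟨k, hk1, hk2⟩ := (hev.and hsmall).exists
  exact absurd (lt_of_le_of_lt hk1 hk2) (lt_irrefl _)

/-- Exhaustion of the open past by the cylinders `Q(0, 2^m)`. -/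
theorem exists_mem_parabolicCylinder_two_pow' {t : ℝ} (ht : t < 0) (x : EuclideanSpace ℝ (Fin 3)) :
    ∃ m : ℕ, ((t, x) : ℝ × EuclideanSpace ℝ (Fin 3)) ∈
      parabolicCylinder ((2 : ℝ) ^ m) (0 : ℝ × EuclideanSpace ℝ (Fin 3)) := by
  obtain ⟨m, hm⟩ := pow_unbounded_of_one_lt (max (-t) ‖x‖ + 1) (by norm_num : (1 : ℝ) < 2)
  refine ⟨m, ?_⟩
  have h1 : -t < (2 : ℝ) ^ m := by linarith [le_max_left (-t) ‖x‖]
  have h2 : ‖x‖ < (2 : ℝ) ^ m := by linarith [le_max_right (-t) ‖x‖]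
  have h3 : (1 : ℝ) ≤ (2 : ℝ) ^ m := one_le_pow₀ (by norm_num)
  rw [mem_parabolicCylinder]
  simp only [Prod.fst_zero, Prod.snd_zero, zero_sub, dist_zero_right]
  refine ⟨⟨?_, ht⟩, h2⟩
  nlinarith

/-- **F3b (PK1 skeleton, verbatim).**  The one-point bound passes to the `L³_loc` limit a.e. on the
slab. -/
theorem ae_apex_of_classZoom {Cu : ℝ}
    {w : ℕ → ℝ → EuclideanSpace ℝ (Fin 3) → EuclideanSpace ℝ (Fin 3)} {Rk : ℕ → ℝ}
    {U : ℝ → EuclideanSpace ℝ (Fin 3) → EuclideanSpace ℝ (Fin 3)}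
    (hRk : Tendsto Rk atTop atTop)
    (hone : ∀ k, ∀ z ∈ parabolicCylinder (Rk k) (0 : ℝ × EuclideanSpace ℝ (Fin 3)),
      ‖w k z.1 z.2‖ ≤ Cu / (Real.sqrt (-z.1) + ‖z.2‖))
    (hUm : ContinuousOn (uncurry U) (Iio (0 : ℝ) ×ˢ univ))
    (hL3 : ∀ r : ℝ, 0 < r → Tendsto (fun k => eLpNorm (uncurry (w k) - uncurry U) 3
      (volume.restrict (parabolicCylinder r (0 : ℝ × EuclideanSpace ℝ (Fin 3))))) atTop (𝓝 0)) :
    ∀ᵐ z ∂(volume.restrict (Iio (0 : ℝ) ×ˢ (univ : Set (EuclideanSpace ℝ (Fin 3))))),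
      ‖U z.1 z.2‖ ≤ Cu / (‖z.2‖ + Real.sqrt (-z.1)) := by
  have hQ : ∀ m : ℕ, ∀ᵐ z ∂(volume.restrict
      (parabolicCylinder ((2 : ℝ) ^ m) (0 : ℝ × EuclideanSpace ℝ (Fin 3)))),
      ‖U z.1 z.2‖ ≤ Cu / (‖z.2‖ + Real.sqrt (-z.1)) := fun m =>
    ae_apex_of_classZoom_cylinder hRk hone hUm (by positivity) (hL3 _ (by positivity))
  have hcover : (Iio (0 : ℝ) ×ˢ (univ : Set (EuclideanSpace ℝ (Fin 3)))) ⊆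
      ⋃ m : ℕ, parabolicCylinder ((2 : ℝ) ^ m) (0 : ℝ × EuclideanSpace ℝ (Fin 3)) := by
    rintro ⟨t, x⟩ ⟨ht, -⟩
    obtain ⟨m, hm⟩ := exists_mem_parabolicCylinder_two_pow' (mem_Iio.1 ht) x
    exact mem_iUnion.2 ⟨m, hm⟩
  exact ae_restrict_of_ae_restrict_of_subset hcover ((ae_restrict_iUnion_iff _ _).2 hQ)

end Summit.NavierStokesRegularity.NavierStokesRegularity.Theorems.QuietScarPocketDoor

end
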